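import Mathlib
import Literature.Probability.Percolation.PercolationProofs
import HarnessLib

/-!
# Crux `PercBurnResprinkle.JumpFireBreak` (stmt-CriticalPhenomena-7204), line `vacant-coins-fresh-spine` — stub `stub_scaleOne`

Helper file for the crux skeleton `Cruxes/JumpFireBreak/Lines/vacant-coins-fresh-spine.lean` (lead
prover-line-stmt-CriticalPhenomena-7204-0).  Proves exactly the registered stub signature; lands with
`--supports stmt-CriticalPhenomena-7204`.

Scale one of the multiscale glue: the local bad event at scale `(M², M)` costs `M` sprinkled edges.

Proof route (Grimmett, *Percolation* (1999), §7.4, static block renormalisation, sprinkling count).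
* `exists_sprinkled_edges_of_walk` (purely combinatorial): for two configurations `ω₁, ω₂` on `ℤ^d`, `ω₂`
  made of lattice edges, and a set `S` of vertices whose `ω₁`-clusters have sup-radius `≤ M`, an `ω₂`-open walk
  inside `S`, started at a vertex of the `ω₁`-cluster of an anchor `z ∈ S` and reaching a vertex at
  coordinate distance `≥ n (M + 1)` from `z`, contains `n` edges of `ω₂ ∖ ω₁` ("sprinkled" edges), listed in
  walk order, the `j`-th one being `s(x_j, x_j + u_j)` with `u_j = ± e_k` a unit step and
  `x_j = z + (d_0 + ⋯ + d_j) + (u_0 + ⋯ + u_{j-1})`, all `d_j ∈ box d M` (a maximal run of `ω₁`-edges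
  stays inside one `ω₁`-cluster, hence within sup-distance `M` of its first vertex).
* `measureReal_sprinkleCylinder_le`: for an injective sequence of `n` pairs, the cylinder event "every label
  lies in `(p, p + ε]`" has `labelMeasure`-probability `≤ ε ^ n` (`Measure.infinitePi_pi`).
* `stub_scaleOne`: make the witnessing walk a simple path (`Walk.bypass`), so the `M` sprinkled edges are
  distinct; union bound over the `(2M²+1)³ · ((2M+1)³)^M · 6^M` parameters `(a - c, d, u)`.
-/

noncomputable section

namespace Summit.CriticalPhenomena.PercolationContinuityZ3.Theorems

open MeasureTheory ProbabilityTheory Literature.Probability.Percolation Literature.Probability.LatticeModels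

/-! ### Combinatorics of sprinkled edges along an open walk -/

/-- Anchor bookkeeping, first point: with parameters `(d₀ :: d, u₀ :: u)` the `0`-th anchor
`z + (d₀ + ⋯) + (⋯)` is `z + d₀`. -/
theorem anchor_zero {d n : ℕ} (z d₀ u₀ : Site d) (dd u : Fin n → Site d) :
    z + Fin.partialSum (Fin.cons d₀ dd : Fin (n + 1) → Site d) (0 : Fin (n + 1)).succ
        + Fin.partialSum (Fin.cons u₀ u : Fin (n + 1) → Site d) (0 : Fin (n + 1)).castSucc = z + d₀ := by
  rw [Fin.partialSum_succ']
  simp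

/-- Anchor bookkeeping, later points: with parameters `(d₀ :: d, u₀ :: u)` based at `z`, the `(j+1)`-st
anchor is the `j`-th anchor of the parameters `(d, u)` based at `z + d₀ + u₀`. -/
theorem anchor_succ {d n : ℕ} (z d₀ u₀ : Site d) (dd u : Fin n → Site d) (j : Fin n) :
    z + Fin.partialSum (Fin.cons d₀ dd : Fin (n + 1) → Site d) j.succ.succ
        + Fin.partialSum (Fin.cons u₀ u : Fin (n + 1) → Site d) j.succ.castSucc =
      (z + d₀ + u₀) + Fin.partialSum dd j.succ + Fin.partialSum u j.castSucc := by
  rw [Fin.castSucc_succ]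
  simp only [Fin.partialSum_succ', Fin.cons_zero, Fin.tail_cons]
  abel

/-- **Sprinkled edges along an open walk** (the combinatorial core of the scale-one bound; Grimmett 1999,
§7.4).  Let `ω₂` consist of lattice edges of `ℤ^d`, let every vertex `v ∈ S` have `ω₁`-cluster inside
`v + box d M`, and let `w` be an `ω₂`-open walk with all vertices in `S`, starting at a vertex `y` of the
`ω₁`-cluster of an anchor `z ∈ S`.  If some vertex of `w` is at distance `≥ n (M + 1)` from `z` in the
`i`-th coordinate, then there are parameters `d u : Fin n → ℤ^d`, `d j ∈ box d M`, `u j` a unit step, such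
that the `n` pairs `e j = s(x j, x j + u j)`, `x j = z + (d 0 + ⋯ + d j) + (u 0 + ⋯ + u (j-1))`, are edges of
`ω₂ ∖ ω₁` occurring in this order as a sublist of the edge list of `w`. -/
theorem exists_sprinkled_edges_of_walk {d M : ℕ} {ω₁ ω₂ : Set (Sym2 (Site d))}
    (hω : ω₂ ⊆ (zdGraph d).edgeSet) {S : Set (Site d)}
    (hS : ∀ v ∈ S, openCluster ω₁ v ⊆ {y | y - v ∈ (box d M : Set (Site d))}) (i : Fin d)
    {y b : Site d} (w : (openGraph ω₂).Walk y b) :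
    ∀ (n : ℕ) (z : Site d), (∀ v ∈ w.support, v ∈ S) → z ∈ S → y ∈ openCluster ω₁ z →
      (∃ v ∈ w.support, (n : ℤ) * ((M : ℤ) + 1) ≤ |v i - z i|) →
      ∃ (dd u : Fin n → Site d) (e : Fin n → Sym2 (Site d)),
        (∀ j, dd j ∈ box d M) ∧ (∀ j, ∃ k : Fin d, u j = Pi.single k 1 ∨ u j = -Pi.single k 1) ∧
        (∀ j, e j = s(z + Fin.partialSum dd j.succ + Fin.partialSum u j.castSucc,
          z + Fin.partialSum dd j.succ + Fin.partialSum u j.castSucc + u j)) ∧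
        (∀ j, e j ∈ ω₂ \ ω₁) ∧ List.Sublist (List.ofFn e) w.edges := by
  -- coordinate bound inside one `ω₁`-cluster
  have hclose : ∀ {z v : Site d}, z ∈ S → v ∈ openCluster ω₁ z → |v i - z i| ≤ M := by
    intro z v hz hv
    have h := hS z hz hv
    simp only [Set.mem_setOf_eq, Finset.mem_coe, mem_box, Pi.sub_apply] at h
    exact abs_le.2 ⟨by linarith [(h i).1], (h i).2⟩
  -- the empty parameter family (case `n = 0`)
  have hzero : ∀ (z : Site d) {y' b' : Site d} (w' : (openGraph ω₂).Walk y' b'),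
      ∃ (dd u : Fin 0 → Site d) (e : Fin 0 → Sym2 (Site d)),
        (∀ j, dd j ∈ box d M) ∧ (∀ j, ∃ k : Fin d, u j = Pi.single k 1 ∨ u j = -Pi.single k 1) ∧
        (∀ j, e j = s(z + Fin.partialSum dd j.succ + Fin.partialSum u j.castSucc,
          z + Fin.partialSum dd j.succ + Fin.partialSum u j.castSucc + u j)) ∧
        (∀ j, e j ∈ ω₂ \ ω₁) ∧ List.Sublist (List.ofFn e) w'.edges := fun z _ _ w' =>
    ⟨Fin.elim0, Fin.elim0, Fin.elim0, fun j => j.elim0, fun j => j.elim0, fun j => j.elim0,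
      fun j => j.elim0, by simp⟩
  induction w with
  | nil =>
    intro n z _ hz hy hfar
    cases n with
    | zero => exact hzero z _
    | succ n =>
      exfalso
      obtain ⟨v, hv, hfar⟩ := hfar
      rw [SimpleGraph.Walk.support_nil, List.mem_singleton] at hv
      subst hv
      have h1 := hclose hz hy
      have h2 : ((M : ℤ) + 1) ≤ ((n : ℤ) + 1) * ((M : ℤ) + 1) :=
        le_mul_of_one_le_left (by positivity) (by linarith [(Nat.cast_nonneg n : (0 : ℤ) ≤ n)])
      push_cast at hfar
      linarith
  | @cons y v₁ b' h w' ih =>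
    intro n z hsupp hz hy hfar
    cases n with
    | zero => exact hzero z _
    | succ n =>
      have hsupp' : ∀ v ∈ w'.support, v ∈ S := fun v hv =>
        hsupp v (by rw [SimpleGraph.Walk.support_cons]; exact List.mem_cons_of_mem _ hv)
      have hv₁S : v₁ ∈ S := hsupp' v₁ w'.start_mem_support
      have hyv₁ : s(y, v₁) ∈ ω₂ := ((openGraph_adj ω₂ y v₁).1 h).1
      -- the far vertex is not `y` itself
      obtain ⟨v, hv, hvfar⟩ := hfar
      have hvw' : v ∈ w'.support := by
        rw [SimpleGraph.Walk.support_cons, List.mem_cons] at hv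
        rcases hv with rfl | hv
        · exfalso
          have h1 := hclose hz hy
          have h2 : ((M : ℤ) + 1) ≤ ((n : ℤ) + 1) * ((M : ℤ) + 1) :=
            le_mul_of_one_le_left (by positivity) (by linarith [(Nat.cast_nonneg n : (0 : ℤ) ≤ n)])
          push_cast at hvfar
          linarith
        · exact hv
      by_cases hω₁ : s(y, v₁) ∈ ω₁
      · -- an `ω₁`-open step: same anchor, same run
        have hy' : v₁ ∈ openCluster ω₁ z :=
          SimpleGraph.Reachable.trans hy
            (SimpleGraph.Adj.reachable ((openGraph_adj ω₁ y v₁).2 ⟨hω₁, h.ne⟩))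
        obtain ⟨dd, u, e, hdd, hu, he, hmem, hsub⟩ :=
          ih (n + 1) z hsupp' hz hy' ⟨v, hvw', hvfar⟩
        refine ⟨dd, u, e, hdd, hu, he, hmem, ?_⟩
        rw [SimpleGraph.Walk.edges_cons]
        exact hsub.trans (List.sublist_cons_self _ _)
      · -- a sprinkled step `s(y, v₁)`: record it and restart the run at `v₁`
        have hadj : (zdGraph d).Adj y v₁ := by
          simpa [SimpleGraph.mem_edgeSet] using hω hyv₁
        obtain ⟨k, hk⟩ := (zdGraph_adj_iff y v₁).1 hadj
        have hu₀ : v₁ - y = Pi.single k 1 ∨ v₁ - y = -Pi.single k 1 := by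
          rcases hk with hk | hk
          · exact Or.inl (by rw [hk]; abel)
          · exact Or.inr (by rw [hk]; abel)
        have hstep : |v₁ i - y i| ≤ 1 := by
          have : v₁ i - y i = (v₁ - y) i := rfl
          rw [this]
          rcases hu₀ with h0 | h0 <;>
          · rw [h0]
            by_cases hik : i = k
            · subst hik; simp
            · simp [hik]
        have hfar' : (n : ℤ) * ((M : ℤ) + 1) ≤ |v i - v₁ i| := by
          have h1 := hclose hz hy
          have h3 : |v i - z i| ≤ |v i - v₁ i| + |v₁ i - y i| + |y i - z i| := by
            calc |v i - z i| = |(v i - v₁ i) + (v₁ i - y i) + (y i - z i)| := by ring_nf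
              _ ≤ |(v i - v₁ i) + (v₁ i - y i)| + |y i - z i| := abs_add_le _ _
              _ ≤ |v i - v₁ i| + |v₁ i - y i| + |y i - z i| := by
                gcongr; exact abs_add_le _ _
          push_cast at hvfar
          nlinarith
        obtain ⟨dd, u, e, hdd, hu, he, hmem, hsub⟩ :=
          ih n v₁ hsupp' hv₁S (mem_openCluster_self ω₁ v₁) ⟨v, hvw', hfar'⟩
        have hbase : z + (y - z) + (v₁ - y) = v₁ := by abel
        refine ⟨(Fin.cons (y - z) dd : Fin (n + 1) → Site d), (Fin.cons (v₁ - y) u : Fin (n + 1) → Site d),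
          (Fin.cons s(y, v₁) e : Fin (n + 1) → Sym2 (Site d)), ?_, ?_, ?_, ?_, ?_⟩
        · refine Fin.cases ?_ (fun j => ?_)
          · simpa using hS z hz hy
          · simpa using hdd j
        · refine Fin.cases ⟨k, by simpa using hu₀⟩ (fun j => ?_)
          simpa using hu j
        · refine Fin.cases ?_ (fun j => ?_)
          · rw [anchor_zero]
            simp
          · rw [anchor_succ, hbase]
            simpa using he j
        · refine Fin.cases ?_ (fun j => ?_)
          · simpa using ⟨hyv₁, hω₁⟩
          · simpa using hmem j
        · rw [SimpleGraph.Walk.edges_cons, List.ofFn_succ]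
          simpa using hsub.cons_cons s(y, v₁)

/-! ### The cylinder estimate -/

/-- **Cost of `n` sprinkled edges.**  For an injective sequence `e` of `n` pairs, the cylinder event
"`p < U (e j) ≤ p + ε` for every `j`" has `labelMeasure`-probability `≤ ε ^ n`: under the product measure
`labelMeasure V = ⨂ Leb|[0,1]` it equals `∏_j Leb((p, p + ε] ∩ [0, 1]) ≤ ε ^ n` (`Measure.infinitePi_pi`).
(The injectivity conjunct makes the event empty for a non-injective sequence.) -/
theorem measureReal_sprinkleCylinder_le {V : Type*} {n : ℕ} (e : Fin n → Sym2 V) (p ε : ℝ)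
    (hε : 0 ≤ ε) :
    (labelMeasure V).real {U | Function.Injective e ∧ ∀ j, p < U (e j) ∧ U (e j) ≤ p + ε} ≤ ε ^ n := by
  classical
  by_cases hinj : Function.Injective e
  · have := isProbabilityMeasure_volume_restrict_unitInterval
    set F : Finset (Sym2 V) := Finset.univ.map ⟨e, hinj⟩
    have hset : {U : Sym2 V → ℝ | Function.Injective e ∧ ∀ j, p < U (e j) ∧ U (e j) ≤ p + ε} =
        Set.pi (↑F) (fun _ => Set.Ioc p (p + ε)) := by
      ext U
      simp [hinj, F, Set.mem_pi]
    have hcard : F.card = n := by simp [F]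
    have hμ : labelMeasure V {U | Function.Injective e ∧ ∀ j, p < U (e j) ∧ U (e j) ≤ p + ε} =
        ((volume.restrict (Set.Icc (0 : ℝ) 1)) (Set.Ioc p (p + ε))) ^ n := by
      rw [hset, labelMeasure, Measure.infinitePi_pi _ (fun _ _ => measurableSet_Ioc), Finset.prod_const,
        hcard]
    have hle : (volume.restrict (Set.Icc (0 : ℝ) 1)) (Set.Ioc p (p + ε)) ≤ ENNReal.ofReal ε := by
      rw [Measure.restrict_apply measurableSet_Ioc]
      calc volume (Set.Ioc p (p + ε) ∩ Set.Icc 0 1) ≤ volume (Set.Ioc p (p + ε)) :=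
            measure_mono Set.inter_subset_left
        _ = ENNReal.ofReal ε := by rw [Real.volume_Ioc, add_sub_cancel_left]
    rw [measureReal_def, hμ, ENNReal.toReal_pow]
    exact pow_le_pow_left₀ ENNReal.toReal_nonneg
      ((ENNReal.toReal_mono ENNReal.ofReal_ne_top hle).trans_eq (ENNReal.toReal_ofReal hε)) n
  · have hempty : {U : Sym2 V → ℝ | Function.Injective e ∧ ∀ j, p < U (e j) ∧ U (e j) ≤ p + ε} = ∅ :=
      Set.eq_empty_of_forall_notMem fun U hU => hinj hU.1
    rw [hempty, measureReal_empty]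
    exact pow_nonneg hε n

/-! ### Scale one -/

/-- Registered stub `stub_scaleOne` of crux stmt-CriticalPhenomena-7204 (line vacant-coins-fresh-spine); see the line
skeleton `Cruxes/JumpFireBreak/Lines/vacant-coins-fresh-spine.lean` for the informal statement and sources. -/
theorem stub_scaleOne :
    ∀ (M : ℕ), 1 ≤ M → ∀ (ε : ℝ), 0 ≤ ε → ∀ (c : Fin 3 → ℤ),
    (labelMeasure (Fin 3 → ℤ)).real
        {U | ∃ a b : Fin 3 → ℤ, a - c ∈ (box 3 (M ^ 2) : Set (Fin 3 → ℤ)) ∧ (∃ i, |b i - c i| = 3 * M ^ 2) ∧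
          configOfLabels (criticalProb (zdGraph 3) (0 : Fin 3 → ℤ) + ε) U (zdGraph 3) ∈
            openConnIn {v | v - c ∈ (box 3 (3 * M ^ 2) : Set (Fin 3 → ℤ)) ∧
              openCluster (configOfLabels (criticalProb (zdGraph 3) (0 : Fin 3 → ℤ)) U (zdGraph 3)) v ⊆
                {y | y - v ∈ (box 3 M : Set (Fin 3 → ℤ))}} a b} ≤
      (2 * (M : ℝ) ^ 2 + 1) ^ 3 * (6 * (2 * (M : ℝ) + 1) ^ 3 * ε) ^ M := by
  classical
  intro M hM ε hε c
  have := isProbabilityMeasure_labelMeasure (Fin 3 → ℤ)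
  -- nothing about the value of `p_c` is used
  generalize criticalProb (zdGraph 3) (0 : Fin 3 → ℤ) = pc
  set dirs : Finset (Site 3) := Finset.univ.image
    fun q : Fin 3 × Bool => if q.2 then Pi.single q.1 (1 : ℤ) else -Pi.single q.1 1
  set P : Finset (Site 3 × ((Fin M → Site 3) × (Fin M → Site 3))) :=
    (box 3 (M ^ 2)) ×ˢ ((Fintype.piFinset fun _ : Fin M => box 3 M) ×ˢ
      (Fintype.piFinset fun _ : Fin M => dirs)) with hP
  -- the edge sequence of a parameter `q = (a - c, d, u)`
  set φ : Site 3 × ((Fin M → Site 3) × (Fin M → Site 3)) → Fin M → Sym2 (Site 3) := fun q j =>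
    s(c + q.1 + Fin.partialSum q.2.1 j.succ + Fin.partialSum q.2.2 j.castSucc,
      c + q.1 + Fin.partialSum q.2.1 j.succ + Fin.partialSum q.2.2 j.castSucc + q.2.2 j) with hφ
  set cyl : Site 3 × ((Fin M → Site 3) × (Fin M → Site 3)) → Set (Sym2 (Site 3) → ℝ) := fun q =>
    {U | Function.Injective (φ q) ∧ ∀ j, pc < U (φ q j) ∧ U (φ q j) ≤ pc + ε} with hcyl
  -- Step 1: the bad event is covered by the cylinders
  have hcover : {U | ∃ a b : Fin 3 → ℤ, a - c ∈ (box 3 (M ^ 2) : Set (Fin 3 → ℤ)) ∧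
      (∃ i, |b i - c i| = 3 * M ^ 2) ∧
        configOfLabels (pc + ε) U (zdGraph 3) ∈
          openConnIn {v | v - c ∈ (box 3 (3 * M ^ 2) : Set (Fin 3 → ℤ)) ∧
            openCluster (configOfLabels pc U (zdGraph 3)) v ⊆
              {y | y - v ∈ (box 3 M : Set (Fin 3 → ℤ))}} a b} ⊆ ⋃ q ∈ P, cyl q := by
    rintro U ⟨a, b, ha, ⟨i, hb⟩, hconn⟩
    -- abstract the two coupled configurations and the vertex set
    have hω : configOfLabels (pc + ε) U (zdGraph 3) ⊆ (zdGraph 3).edgeSet := fun e he => he.1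
    generalize hω₁ : configOfLabels pc U (zdGraph 3) = ω₁ at hconn
    generalize hω₂ : configOfLabels (pc + ε) U (zdGraph 3) = ω₂ at hconn hω
    have hS : ∀ v ∈ {v : Site 3 | v - c ∈ (box 3 (3 * M ^ 2) : Set (Fin 3 → ℤ)) ∧
        openCluster ω₁ v ⊆ {y | y - v ∈ (box 3 M : Set (Fin 3 → ℤ))}},
        openCluster ω₁ v ⊆ {y | y - v ∈ (box 3 M : Set (Site 3))} := fun v hv => hv.2
    generalize hSdef : {v : Site 3 | v - c ∈ (box 3 (3 * M ^ 2) : Set (Fin 3 → ℤ)) ∧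
        openCluster ω₁ v ⊆ {y | y - v ∈ (box 3 M : Set (Fin 3 → ℤ))}} = S at hconn hS
    obtain ⟨haS, hbS, ⟨w₀⟩⟩ := hconn
    -- a simple open path from `a` to `b` inside `S`
    have hsupp₁ : ∀ v ∈ (w₀.map (SimpleGraph.Embedding.induce S).toHom).support, v ∈ S := by
      intro v hv
      rw [SimpleGraph.Walk.support_map] at hv
      obtain ⟨x, -, rfl⟩ := List.mem_map.1 hv
      exact x.2
    generalize hw₁ : w₀.map (SimpleGraph.Embedding.induce S).toHom = w₁ at hsupp₁
    have hwpath : w₁.bypass.IsPath := w₁.bypass_isPath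
    have hsupp : ∀ v ∈ w₁.bypass.support, v ∈ S := fun v hv =>
      hsupp₁ v (w₁.support_bypass_subset_support hv)
    generalize hw : w₁.bypass = w at hwpath hsupp
    -- the endpoint `b` is far from `a` in coordinate `i`
    have hfar : ∃ v ∈ w.support, (M : ℤ) * ((M : ℤ) + 1) ≤ |v i - a i| := by
      refine ⟨b, w.end_mem_support, ?_⟩
      have ha' : |a i - c i| ≤ (M : ℤ) ^ 2 := by
        rw [Finset.mem_coe, mem_box] at ha
        have h := ha i
        simp only [Pi.sub_apply] at h
        push_cast at h
        exact abs_le.2 ⟨h.1, h.2⟩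
      have hb' : |b i - c i| = 3 * (M : ℤ) ^ 2 := by exact_mod_cast hb
      have htri : |b i - c i| - |a i - c i| ≤ |b i - a i| := by
        have := abs_sub_abs_le_abs_sub (b i - c i) (a i - c i)
        rwa [show b i - c i - (a i - c i) = b i - a i by ring] at this
      have hM1 : (1 : ℤ) ≤ M := by exact_mod_cast hM
      nlinarith
    obtain ⟨dd, u, e, hdd, hu, he, hmem, hsub⟩ :=
      exists_sprinkled_edges_of_walk hω hS i w M a hsupp haS (mem_openCluster_self ω₁ a) hfar
    -- the parameter `q = (a - c, dd, u)`
    have hφe : φ (a - c, (dd, u)) = e := by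
      funext j
      rw [he j, hφ]
      simp only [add_sub_cancel]
    refine Set.mem_iUnion₂.2 ⟨(a - c, (dd, u)), ?_, ?_⟩
    · simp only [hP, Finset.mem_product, Fintype.mem_piFinset]
      refine ⟨ha, hdd, fun j => ?_⟩
      obtain ⟨k, hk | hk⟩ := hu j
      · exact Finset.mem_image.2 ⟨(k, true), Finset.mem_univ _, by simp [hk]⟩
      · exact Finset.mem_image.2 ⟨(k, false), Finset.mem_univ _, by simp [hk]⟩
    · rw [hcyl, Set.mem_setOf_eq, hφe]
      refine ⟨List.nodup_ofFn.1 (hsub.nodup hwpath.edges_nodup), fun j => ?_⟩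
      obtain ⟨hj₂, hj₁⟩ := hmem j
      subst hω₁ hω₂
      have hj₁' : ¬ U (e j) ≤ pc := fun hle => hj₁ ⟨hj₂.1, hle⟩
      exact ⟨lt_of_not_ge hj₁', hj₂.2⟩
  -- Step 2: count the parameters
  have hdirs_card : (dirs.card : ℝ) ≤ 6 := by
    have h : dirs.card ≤ 6 := Finset.card_image_le.trans (by simp)
    exact_mod_cast h
  have hPcard : (P.card : ℝ) ≤ (2 * (M : ℝ) ^ 2 + 1) ^ 3 * (((2 * (M : ℝ) + 1) ^ 3) ^ M * 6 ^ M) := by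
    have h : P.card = (2 * M ^ 2 + 1) ^ 3 * (((2 * M + 1) ^ 3) ^ M * dirs.card ^ M) := by
      simp only [hP, Finset.card_product, Fintype.card_piFinset_const, card_box]
    rw [h]
    push_cast
    gcongr
  -- Step 3: union bound
  calc (labelMeasure (Fin 3 → ℤ)).real _
      ≤ (labelMeasure (Fin 3 → ℤ)).real (⋃ q ∈ P, cyl q) := measureReal_mono hcover (measure_ne_top _ _)
    _ ≤ ∑ q ∈ P, (labelMeasure (Fin 3 → ℤ)).real (cyl q) := measureReal_biUnion_finset_le P cyl
    _ ≤ ∑ q ∈ P, ε ^ M := Finset.sum_le_sum fun q _ => measureReal_sprinkleCylinder_le (φ q) pc ε hε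
    _ = P.card * ε ^ M := by rw [Finset.sum_const, nsmul_eq_mul]
    _ ≤ (2 * (M : ℝ) ^ 2 + 1) ^ 3 * (((2 * (M : ℝ) + 1) ^ 3) ^ M * 6 ^ M) * ε ^ M := by
      gcongr
    _ = (2 * (M : ℝ) ^ 2 + 1) ^ 3 * (6 * (2 * (M : ℝ) + 1) ^ 3 * ε) ^ M := by
      rw [mul_pow, mul_pow]; ring

end Summit.CriticalPhenomena.PercolationContinuityZ3.Theorems

end
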